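import Mathlib
import Summits.ResolutionOfSingularities.ResolutionOfSingularities.Theorems.WeightedInvariantLocalWeightedDropTOT2BridgePresByTransfer
import Summits.ResolutionOfSingularities.ResolutionOfSingularities.Theorems.WeightedInvariantLocalWeightedDropTOT2BridgePresentedSuccAxes

/-!
# TOT2-LINE v1.3, regime (P): THE DECORATED STEPS (P2)/(P2c) IN THE LEAD'S INTERFACE (res-L1-w43-stub-2 g5)

Sub-problem `ResolutionOfSingularities`, ENGINE crux `stmt-ResolutionOfSingularities-8899` (`LocalWeightedDrop`), inner tame loop at
`m + 1 = 3`, S-ASM by regimes.  The lead's assembly `TameFourTupleDrop.regimePresented_of_pieces` (…NCResRegimePresentedAssembly,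
res-L1-w43-lead-1 g5) (and `regimeLetter_of_pieces`, …NCResRegimeLetterAssembly) take the decorated steps as hypotheses `hP2′` (off the conflict: the selector strategy's move, successors recorded by
`PolyDescent.SuccFamilySel`) and `hP2c′` (at a conflict: the point move, successors recorded by `PolyDescent.PointFamilySel`), both over the record
`Decoration.PresBy δ d A N Θ`, in the v2 SHAPE «every answer is an ORDER DROP or a same-head RECORDED successor».  This file DISCHARGES them for the LAZY selector `PolyDescent.prepSelWP` (prepare only when not well-prepared —
the selector that never bends an old letter, …PolyDescentSelDefs):
* `Decoration.PresBy.moveClause_point` — the point move read through the record (both uses);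
* `Decoration.PresBy.exists_move_of_not_conflict` — (P2′): curve `V(y,u₁)` / curve `V(y,u₂)` / graph curve after shear and lazy preparation
  (off the conflict `u₂ ∉ N`) / point family;
* `Decoration.PresBy.exists_move_point` — (P2c′);
* `presBy_hsel_prepSelWP` — the selector hypothesis `hsel` at EVERY degree (degree `0`: empty Newton set, well-prepared, selector `0`);
* `presBy_hP2'_prepSelWP`, `presBy_hP2c'_prepSelWP` — the two hypotheses of `stub_regimeLetter_of_pieces` / `stub_regimePresented_of_pieces₂` VERBATIM, with
  `ψsel k d := PolyDescent.prepSelWP d`.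
Ingredients: the near-answer presentations with axes (…PresentedSuccAxes), the record transfer (…PresByTransfer), the far answer
(`o′ = 0`, …TOT2BridgeDecorated/…DecoratedCurve), well-preparedness of every successor (`PolyDescent.wellPrepared_divOneT/…/blowOneT`).

All statements are ours (engine bookkeeping); nothing here is a statement of [CJS] or [CP-char2].
-/

set_option linter.dupNamespace false -- mandated namespace of this single-conjunct summit

noncomputable section

namespace Summit.ResolutionOfSingularities.ResolutionOfSingularities.Theorems

namespace TameFourTupleDrop

open MvPowerSeries Literature.AlgebraicGeometry.Resolution

variable {k : Type} [Field k]

section Steps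

variable {b : MvPowerSeries (Fin (2 + 1)) k} {δ : Decoration k 2} {Θ : Fin (2 + 1) → MvPowerSeries (Fin (2 + 1)) k} {d : ℕ}
  {A : Fin d → MvPowerSeries (Fin 2) k} {N : Finset (Fin 2)}

/-- The degree of a presented state of the `o ≥ 2` phase is positive. -/
theorem Decoration.pos_of_c_eq {δ : Decoration k 2} {d : ℕ} (ho : 2 ≤ δ.o) (hcd : δ.c = d) : 0 < d := by
  rw [← hcd, Decoration.c]; omega

/-- No history ⇒ no history after a same-head step. -/
theorem Decoration.O_transform_eq_empty_of_head_eq {δ : Decoration k 2} {Φ : Fin (2 + 1) → MvPowerSeries (Fin (2 + 1)) k}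
    {w : Fin (2 + 1) → ℕ} {c : Fin (2 + 1) → k} {i : Fin (2 + 1)} (hhead : (δ.transform Φ w c i).head = δ.head) (hO : δ.O = ∅) :
    (δ.transform Φ w c i).O = ∅ := by
  classical
  rw [Decoration.O_transform_eq_of_head_eq' hhead, hO]
  unfold Decoration.newLetters
  rw [Finset.filter_empty, Finset.image_empty]

/-- **With a record, a label that is not lazily well-prepared after a shear forces `O = ∅`**: an old letter gives `A₀ = 0`, which the shear keeps,
and a label with vanishing constant slot is well-prepared. -/
theorem Decoration.PresBy.O_eq_empty_of_not_wellPrepared_shearT (h : δ.PresBy d A N Θ) (hd : 0 < d) (g : MvPowerSeries (Fin 2) k)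
    (hWP : ¬ PolyDescent.WellPrepared d (PolyDescent.shearT g A)) : δ.O = ∅ := by
  rcases Finset.eq_empty_or_nonempty δ.O with h0 | hne
  · exact h0
  · exfalso
    obtain ⟨U, hU, hP⟩ := h.exists_eq
    have hA0 : A ⟨0, hd⟩ = 0 := apply_zero_eq_zero_of_presentation h.1 hU hP hd hne
    exact hWP (PolyDescent.wellPrepared_of_apply_zero_eq_zero hd (PolyDescent.shearT_apply_zero hd _ hA0))

/-- **THE POINT MOVE READ THROUGH THE RECORD** (`k` algebraically closed): from a recorded state of the polygon regime the point move
`(Θ, 𝟙)` is answered, at some live slot, by an admissible successor that drops the head, or keeps it and is RECORDED by a well-prepared member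
of the lazy point family `PointFamilySel d (prepSelWP d) A N`. -/
theorem Decoration.PresBy.moveClause_point [IsAlgClosed k] (hadm : Admissible b δ) (ho : 2 ≤ δ.o) (hcd : δ.c = d)
    (h : δ.PresBy d A N Θ) (hin : PolyDescent.InPoly d A) :
    MoveClause b Θ (fun _ => 1)
      (fun b' => ∃ δ' : Decoration k 2, Admissible b' δ' ∧ ((δ'.o < δ.o) ∨ (δ'.head = δ.head ∧
        ∃ (A' : Fin d → MvPowerSeries (Fin 2) k) (N' : Finset (Fin 2)) (Θ' : Fin (2 + 1) → MvPowerSeries (Fin (2 + 1)) k),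
          δ'.PresBy d A' N' Θ' ∧ PolyDescent.WellPrepared d A' ∧ PolyDescent.PointFamilySel d (PolyDescent.prepSelWP d) A N A' N'))) := by
  classical
  have hd : 0 < d := Decoration.pos_of_c_eq ho hcd
  obtain ⟨U, hU, hP⟩ := h.exists_eq
  have hperm₁ := h.1
  have hf : δ.f ≠ 0 := hadm.2.1.ne_zero
  intro pt hconv hpt Aexp G hfac hG
  by_cases hγ : pt (Fin.last 2) = 0
  · by_cases hc0 : pt 0 = 0
    · -- slot `u₂`: label `blowTwo A`, boundary `insert 1 (N.filter (· = 0))`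
      have hc1 : pt 1 ≠ 0 := pointAnswer_one_ne_zero hpt hγ hc0
      have hc1' : pt (Fin.castSucc 1) ≠ 0 := hc1
      have hc0' : pt (Fin.castSucc 0) = 0 := hc0
      have hadm' := admissible_transform hadm hperm₁ hconv hfac hG hc1'
      by_cases hlt : (δ.transform Θ (fun _ => 1) pt (Fin.castSucc 1)).o < δ.o
      · exact ⟨Fin.castSucc 1, hc1', _, hadm', Or.inl hlt⟩
      · have heq := h.head_transform_eq_of_not_lt hperm₁ hconv hf hc1' hγ hlt
        have hnear := Decoration.o_transform_eq_of_head_eq' heq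
        obtain ⟨Θ', H', hperm', hax, hΘ'l, hH', hP'⟩ :=
          Decoration.presentation_pointSucc_one_axes hperm₁ hf hU hin.2.1 hP hγ hc0 hc1 hnear
        exact ⟨Fin.castSucc 1, hc1', _, hadm', Or.inr ⟨heq, PolyDescent.blowTwoT d A, insert 1 (N.filter fun l => l = 0), Θ',
          h.transform_one heq hc1' hc0' hperm' hax hΘ'l hc1 hH' hP', PolyDescent.wellPrepared_blowTwoT A hin.2.1 hin.1,
          Or.inr (Or.inr ⟨rfl, rfl⟩)⟩⟩
    · -- slot `u₁`
      have hc0' : pt (Fin.castSucc 0) ≠ 0 := hc0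
      have hadm' := admissible_transform hadm hperm₁ hconv hfac hG hc0'
      by_cases hlt : (δ.transform Θ (fun _ => 1) pt (Fin.castSucc 0)).o < δ.o
      · exact ⟨Fin.castSucc 0, hc0', _, hadm', Or.inl hlt⟩
      · have heq := h.head_transform_eq_of_not_lt hperm₁ hconv hf hc0' hγ hlt
        have hnear := Decoration.o_transform_eq_of_head_eq' heq
        obtain ⟨Θ', H', hperm', hax, hΘ'l, hH', hP'⟩ :=
          Decoration.presentation_pointSucc_zero_axes hperm₁ hf hU hin.2.1 hP hγ hc0 hnear
        refine ⟨Fin.castSucc 0, hc0', _, hadm', Or.inr ⟨heq, ?_⟩⟩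
        by_cases hc1 : pt 1 = 0
        · -- origin of the `u₁`-chart: label `blowOne A`, boundary `insert 0 (N.filter (· = 1))`
          have hsh : PolyDescent.shearT (C (pt 1 / pt 0)) A = A := by
            rw [hc1, zero_div, map_zero]; exact PolyDescent.shearT_zero A
          rw [hsh] at hP'
          have hc1' : pt (Fin.castSucc 1) = 0 := hc1
          exact ⟨PolyDescent.blowOneT d A, insert 0 (N.filter fun l => l = 1), Θ',
            h.transform_zero_of_eq_zero heq hc0' hc1' hperm' hax hΘ'l hc0 hH' hP', PolyDescent.wellPrepared_blowOneT A hin.2.1 hin.1,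
            Or.inl ⟨rfl, rfl⟩⟩
        · -- translated point: label `blowOne (shear_λ A)` lazily prepared, boundary `{0}`
          have hl : pt 1 / pt 0 ≠ 0 := div_ne_zero hc1 hc0
          have hc1' : pt (Fin.castSucc 1) ≠ 0 := hc1
          set Y := PolyDescent.shearT (C (pt 1 / pt 0)) A with hY
          have hposY : PolyDescent.IsPosT d Y := PolyDescent.isPosT_shearT _ hin.2.1
          have hpres' := h.transform_zero_of_ne_zero heq hc0' hc1' hperm' hax hΘ'l hc0 hH' hP'
          by_cases hWPY : PolyDescent.WellPrepared d Y
          · refine ⟨PolyDescent.blowOneT d Y, {0}, Θ', hpres', PolyDescent.wellPrepared_blowOneT Y hposY hWPY,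
              Or.inr (Or.inl ⟨pt 1 / pt 0, hl, ?_, rfl⟩)⟩
            rw [← hY, PolyDescent.prepSelWP_of_wellPrepared hWPY, WildMonic.shift_zero]
          · obtain ⟨hχ0, hposB, hWPB, -⟩ := PolyDescent.isPrepRecentring_prepSelWP (PolyDescent.stub_polyPrep k d hd) hposY
            set χ := PolyDescent.prepSelWP d Y with hχ
            have hχ1 : (1 : ℕ∞) ≤ χ.order := nat_le_order fun e he => by
              have he0 : e = 0 := by
                have : e.degree = 0 := by exact_mod_cast Nat.lt_one_iff.mp (by exact_mod_cast he)
                exact (Finsupp.degree_eq_zero_iff e).mp this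
              rw [he0, coeff_zero_eq_constantCoeff_apply, hχ0]
            have hcomm := PolyDescent.blowOneT_shift Y _ (fun j => (hposY j).le) hχ1
            have hchi1 : constantCoeff (MonicDescent.blowOne 1 χ) = 0 := by
              rw [MonicDescent.constantCoeff_blowOne_one_eq]
              exact PolyDescent.coeff_single_one_eq_zero_of_isPosT_shift hd hposY hχ0 hposB 0
            have hO : δ.O = ∅ := h.O_eq_empty_of_not_wellPrepared_shearT hd _ hWPY
            have hO' := Decoration.O_transform_eq_empty_of_head_eq heq hO
            obtain ⟨Θ'', hpres''⟩ := hpres'.recentre hO' hchi1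
            refine ⟨_, {0}, Θ'', hpres'', ?_, Or.inr (Or.inl ⟨pt 1 / pt 0, hl, ?_, rfl⟩)⟩
            · rw [← hcomm]; exact PolyDescent.wellPrepared_blowOneT _ hposB hWPB
            · rw [← hcomm]
  · -- far answer: the order letter drops to `0`
    have hγ0 : pt (Fin.last 2) ≠ 0 := hγ
    have hadm' := admissible_transform hadm hperm₁ hconv hfac hG hγ0
    refine ⟨Fin.last 2, hγ0, _, hadm', Or.inl ?_⟩
    rw [o_transform_eq_zero_of_gamma_ne_zero hperm₁ hf hU hin.2.1 hP hγ0 (Fin.last 2)]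
    omega

/-- **(P2c) THE POINT MOVE AT A RECORDED STATE** — in the interface of `regimePresented_of_pieces`. -/
theorem Decoration.PresBy.exists_move_point [IsAlgClosed k] (hadm : Admissible b δ) (ho : 2 ≤ δ.o) (hcd : δ.c = d)
    (h : δ.PresBy d A N Θ) (hin : PolyDescent.InPoly d A) :
    ∃ (Φ : Fin (2 + 1) → MvPowerSeries (Fin (2 + 1)) k) (w : Fin (2 + 1) → ℕ), IsCountMove Φ w ∧ MoveClause b Φ w
      (fun b' => ∃ δ' : Decoration k 2, Admissible b' δ' ∧ ((δ'.o < δ.o) ∨ (δ'.head = δ.head ∧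
        ∃ (A' : Fin d → MvPowerSeries (Fin 2) k) (N' : Finset (Fin 2)) (Θ' : Fin (2 + 1) → MvPowerSeries (Fin (2 + 1)) k),
          δ'.PresBy d A' N' Θ' ∧ PolyDescent.WellPrepared d A' ∧ PolyDescent.PointFamilySel d (PolyDescent.prepSelWP d) A N A' N'))) :=
  ⟨Θ, _, h.1.1, h.moveClause_point hadm ho hcd hin⟩

/-- **(P2) THE STRATEGY MOVE OFF THE CONFLICT AT A RECORDED STATE** (`k` algebraically closed) — in the interface of
`regimePresented_of_pieces`: some count move is answered, at some live slot, by an admissible successor that drops the head, or keeps it and is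
RECORDED by a well-prepared family successor `SuccFamilySel d (prepSelWP d) A N A′ N′` of the lazy strategy. -/
theorem Decoration.PresBy.exists_move_of_not_conflict [IsAlgClosed k] (hadm : Admissible b δ) (ho : 2 ≤ δ.o) (hcd : δ.c = d)
    (h : δ.PresBy d A N Θ) (hin : PolyDescent.InPoly d A) (hnc : ¬ NCPoly.Conflict d A N) :
    ∃ (Φ : Fin (2 + 1) → MvPowerSeries (Fin (2 + 1)) k) (w : Fin (2 + 1) → ℕ), IsCountMove Φ w ∧ MoveClause b Φ w
      (fun b' => ∃ δ' : Decoration k 2, Admissible b' δ' ∧ ((δ'.o < δ.o) ∨ (δ'.head = δ.head ∧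
        ∃ (A' : Fin d → MvPowerSeries (Fin 2) k) (N' : Finset (Fin 2)) (Θ' : Fin (2 + 1) → MvPowerSeries (Fin (2 + 1)) k),
          δ'.PresBy d A' N' Θ' ∧ PolyDescent.WellPrepared d A' ∧ PolyDescent.SuccFamilySel d (PolyDescent.prepSelWP d) A N A' N'))) := by
  classical
  have hd : 0 < d := Decoration.pos_of_c_eq ho hcd
  obtain ⟨U, hU, hP⟩ := h.exists_eq
  have hperm₁ := h.1
  have hf : δ.f ≠ 0 := hadm.2.1.ne_zero
  by_cases h1 : PolyDescent.IsPermissibleOneT d A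
  · -- curve `V(y,u₁)`
    have hdiv : ∀ j, A j = X 0 ^ (d - (j : ℕ)) * PolyDescent.divOneT d A j := fun j => PolyDescent.eq_X_pow_mul_divOneT h1 j
    have hpermw := isBPermissible_curve_of_presentation hperm₁ hf 0 hdiv hU hP
    refine ⟨Θ, _, hpermw.1, ?_⟩
    intro pt hconv hpt Aexp G hfac hG
    by_cases hγ : pt (Fin.last 2) = 0
    · have hc0 := castSucc_ne_zero_of_curveAnswer 0 hconv hpt hγ
      have hc1 : pt (Fin.castSucc 1) = 0 := hconv (Fin.castSucc 1) (by simp)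
      have hadm' := admissible_transform hadm hpermw hconv hfac hG hc0
      refine ⟨Fin.castSucc 0, hc0, _, hadm', ?_⟩
      by_cases hlt : (δ.transform Θ (fun l : Fin (2 + 1) => if l = Fin.castSucc 0 ∨ l = Fin.last 2 then (1 : ℕ) else 0) pt
          (Fin.castSucc 0)).o < δ.o
      · exact Or.inl hlt
      · have heq := h.head_transform_eq_of_not_lt hpermw hconv hf hc0 hγ hlt
        have hnear := Decoration.o_transform_eq_of_head_eq' heq
        obtain ⟨Θ', H', hperm', hax, hΘ'l, hH', hP'⟩ :=
          Decoration.presentation_curveSucc_zero_axes hperm₁ hf hU hdiv hP hconv hγ hc0 hnear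
        exact Or.inr ⟨heq, PolyDescent.divOneT d A, insert 0 (N.filter fun l => l = 1), Θ',
          h.transform_zero_of_eq_zero heq hc0 hc1 hperm' hax hΘ'l hc0 hH' hP', PolyDescent.wellPrepared_divOneT A h1 hin.1,
          Or.inl ⟨h1, rfl, rfl⟩⟩
    · have hγ0 : pt (Fin.last 2) ≠ 0 := hγ
      have hadm' := admissible_transform hadm hpermw hconv hfac hG hγ0
      refine ⟨Fin.last 2, hγ0, _, hadm', Or.inl ?_⟩
      rw [o_transform_curve_eq_zero_of_gamma_ne_zero' hperm₁ hf hU hin.2.1 hP hdiv hconv hγ0 (Fin.last 2)]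
      omega
  by_cases h2 : PolyDescent.IsPermissibleTwoT d A
  · -- curve `V(y,u₂)`
    have hdiv : ∀ j, A j = X 1 ^ (d - (j : ℕ)) * PolyDescent.divTwoT d A j := fun j => PolyDescent.eq_X_pow_mul_divTwoT h2 j
    have hpermw := isBPermissible_curve_of_presentation hperm₁ hf 1 hdiv hU hP
    refine ⟨Θ, _, hpermw.1, ?_⟩
    intro pt hconv hpt Aexp G hfac hG
    by_cases hγ : pt (Fin.last 2) = 0
    · have hc1 := castSucc_ne_zero_of_curveAnswer 1 hconv hpt hγ
      have hc0 : pt (Fin.castSucc 0) = 0 := hconv (Fin.castSucc 0) (by simp)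
      have hadm' := admissible_transform hadm hpermw hconv hfac hG hc1
      refine ⟨Fin.castSucc 1, hc1, _, hadm', ?_⟩
      by_cases hlt : (δ.transform Θ (fun l : Fin (2 + 1) => if l = Fin.castSucc 1 ∨ l = Fin.last 2 then (1 : ℕ) else 0) pt
          (Fin.castSucc 1)).o < δ.o
      · exact Or.inl hlt
      · have heq := h.head_transform_eq_of_not_lt hpermw hconv hf hc1 hγ hlt
        have hnear := Decoration.o_transform_eq_of_head_eq' heq
        obtain ⟨Θ', H', hperm', hax, hΘ'l, hH', hP'⟩ :=
          Decoration.presentation_curveSucc_one_axes hperm₁ hf hU hdiv hP hconv hγ hc1 hnear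
        exact Or.inr ⟨heq, PolyDescent.divTwoT d A, insert 1 (N.filter fun l => l = 0), Θ',
          h.transform_one heq hc1 hc0 hperm' hax hΘ'l hc1 hH' hP', PolyDescent.wellPrepared_divTwoT A h2 hin.1,
          Or.inr (Or.inl ⟨h1, h2, rfl, rfl⟩)⟩
    · have hγ0 : pt (Fin.last 2) ≠ 0 := hγ
      have hadm' := admissible_transform hadm hpermw hconv hfac hG hγ0
      refine ⟨Fin.last 2, hγ0, _, hadm', Or.inl ?_⟩
      rw [o_transform_curve_eq_zero_of_gamma_ne_zero' hperm₁ hf hU hin.2.1 hP hdiv hconv hγ0 (Fin.last 2)]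
      omega
  by_cases h3 : PolyDescent.HasGraphCurveT d A
  · -- graph curve, off the conflict: shear, lazy preparation, curve `V(y,u₂)` in the new record
    have h1N : (1 : Fin 2) ∉ N := fun h1N => hnc ⟨h1, h2, h3, h1N⟩
    obtain ⟨ψ, -, -, hpermψ⟩ := PolyDescent.graphShearT_spec h3
    set Y := PolyDescent.shearT (PolyDescent.graphShearT d A) A with hY
    have hposY : PolyDescent.IsPosT d Y := PolyDescent.isPosT_shearT _ hin.2.1
    obtain ⟨hχ0, hposB, hWPB, -⟩ := PolyDescent.isPrepRecentring_prepSelWP (PolyDescent.stub_polyPrep k d hd) hposY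
    set B := WildMonic.shift d Y (PolyDescent.prepSelWP d Y) with hB
    have hpermB : PolyDescent.IsPermissibleTwoT d B := by
      refine PolyDescent.isPermissibleTwoT_of_wellPrepared_of_isPermissibleTwoT_shift hd hWPB
        (φ := ψ - PolyDescent.prepSelWP d Y) ?_
      rw [hB, PolyDescent.shift_shift, sub_add_cancel]
      exact hpermψ
    obtain ⟨Θ₁, hpres₁⟩ := h.shear h1N (PolyDescent.graphShearT d A)
    have hpresB : ∃ Θ₂ : Fin (2 + 1) → MvPowerSeries (Fin (2 + 1)) k, δ.PresBy d B N Θ₂ := by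
      by_cases hWPY : PolyDescent.WellPrepared d Y
      · refine ⟨Θ₁, ?_⟩
        rw [hB, PolyDescent.prepSelWP_of_wellPrepared hWPY, WildMonic.shift_zero]
        exact hpres₁
      · exact hpres₁.recentre (h.O_eq_empty_of_not_wellPrepared_shearT hd _ hWPY) hχ0
    obtain ⟨Θ₂, hpres₂⟩ := hpresB
    obtain ⟨U₂, hU₂, hP₂⟩ := hpres₂.exists_eq
    have hdiv : ∀ j, B j = X 1 ^ (d - (j : ℕ)) * PolyDescent.divTwoT d B j := fun j => PolyDescent.eq_X_pow_mul_divTwoT hpermB j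
    have hpermw := isBPermissible_curve_of_presentation hpres₂.1 hf 1 hdiv hU₂ hP₂
    refine ⟨Θ₂, _, hpermw.1, ?_⟩
    intro pt hconv hpt Aexp G hfac hG
    by_cases hγ : pt (Fin.last 2) = 0
    · have hc1 := castSucc_ne_zero_of_curveAnswer 1 hconv hpt hγ
      have hc0 : pt (Fin.castSucc 0) = 0 := hconv (Fin.castSucc 0) (by simp)
      have hadm' := admissible_transform hadm hpermw hconv hfac hG hc1
      refine ⟨Fin.castSucc 1, hc1, _, hadm', ?_⟩
      by_cases hlt : (δ.transform Θ₂ (fun l : Fin (2 + 1) => if l = Fin.castSucc 1 ∨ l = Fin.last 2 then (1 : ℕ) else 0) pt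
          (Fin.castSucc 1)).o < δ.o
      · exact Or.inl hlt
      · have heq := hpres₂.head_transform_eq_of_not_lt hpermw hconv hf hc1 hγ hlt
        have hnear := Decoration.o_transform_eq_of_head_eq' heq
        obtain ⟨Θ', H', hperm', hax, hΘ'l, hH', hP'⟩ :=
          Decoration.presentation_curveSucc_one_axes hpres₂.1 hf hU₂ hdiv hP₂ hconv hγ hc1 hnear
        exact Or.inr ⟨heq, PolyDescent.divTwoT d B, insert 1 (N.filter fun l => l = 0), Θ',
          hpres₂.transform_one heq hc1 hc0 hperm' hax hΘ'l hc1 hH' hP', PolyDescent.wellPrepared_divTwoT B hpermB hWPB,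
          Or.inr (Or.inr (Or.inl ⟨h1, h2, h3, h1N, rfl, rfl⟩))⟩
    · have hγ0 : pt (Fin.last 2) ≠ 0 := hγ
      have hadm' := admissible_transform hadm hpermw hconv hfac hG hγ0
      refine ⟨Fin.last 2, hγ0, _, hadm', Or.inl ?_⟩
      rw [o_transform_curve_eq_zero_of_gamma_ne_zero' hpres₂.1 hf hU₂ hposB hP₂ hdiv hconv hγ0 (Fin.last 2)]
      omega
  · -- no curve: the point family
    refine ⟨Θ, _, hperm₁.1, (h.moveClause_point hadm ho hcd hin).mono fun b' hb' => ?_⟩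
    obtain ⟨δ', hadm', hor⟩ := hb'
    refine ⟨δ', hadm', hor.imp_right fun hsame => ⟨hsame.1, ?_⟩⟩
    obtain ⟨A', N', Θ', hpres', hWP', hpf⟩ := hsame.2
    exact ⟨A', N', Θ', hpres', hWP', Or.inr (Or.inr (Or.inr ⟨h1, h2, h3, hpf⟩))⟩

end Steps

/-! ## The selector hypothesis `hsel` for the lazy selector, at every degree -/

/-- A label of degree `0` is well-prepared (its Newton set is empty). -/
theorem wellPrepared_degree_zero (A : Fin 0 → MvPowerSeries (Fin 2) k) : PolyDescent.WellPrepared 0 A := by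
  intro P hP _
  obtain ⟨j, -⟩ := (WildMonic.mem_newtonSet_iff A P).mp hP.1
  exact Fin.elim0 j

/-- **THE LAZY SELECTOR IS A PREPARING RE-CENTRING AT EVERY DEGREE** (degree `0`: the label is well-prepared and the selector is `0`;
positive degree: ρ-P `PolyDescent.stub_polyPrep`). -/
theorem isPrepRecentring_prepSelWP_all (d : ℕ) (X : Fin d → MvPowerSeries (Fin 2) k) (hX : PolyDescent.IsPosT d X) :
    PolyDescent.IsPrepRecentring d X (PolyDescent.prepSelWP d X) := by
  rcases Nat.eq_zero_or_pos d with rfl | hd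
  · have hWP := wellPrepared_degree_zero X
    rw [PolyDescent.prepSelWP_of_wellPrepared hWP]
    exact PolyDescent.isPrepRecentring_zero hX hWP
  · exact PolyDescent.isPrepRecentring_prepSelWP (PolyDescent.stub_polyPrep k d hd) hX

/-- **`hsel` OF `stub_regimeLetter_of_pieces` / `stub_regimePresented_of_pieces` FOR `ψsel k d := PolyDescent.prepSelWP d`.** -/
theorem presBy_hsel_prepSelWP : ∀ (p : ℕ), p.Prime → ∀ (k : Type) [Field k] [CharP k p] [IsAlgClosed k],
    ∀ (d : ℕ) (X : Fin d → MvPowerSeries (Fin 2) k), PolyDescent.IsPosT d X →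
      PolyDescent.IsPrepRecentring d X (PolyDescent.prepSelWP (k := k) d X) :=
  fun _ _ _ _ _ _ d X hX => isPrepRecentring_prepSelWP_all d X hX

/-! ## The two step hypotheses of `stub_regimeLetter_of_pieces` / `stub_regimePresented_of_pieces₂`, verbatim, for the lazy selector -/

/-- **`hP2'` OF `stub_regimeLetter_of_pieces` / `stub_regimePresented_of_pieces₂` FOR `ψsel k d := PolyDescent.prepSelWP d`.** -/
theorem presBy_hP2'_prepSelWP : ∀ (p : ℕ), p.Prime → ∀ (k : Type) [Field k] [CharP k p] [IsAlgClosed k],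
    ∀ (b : MvPowerSeries (Fin 3) k) (δ : Decoration k 2) (d : ℕ) (A : Fin d → MvPowerSeries (Fin 2) k) (N : Finset (Fin 2))
      (Θ : Fin 3 → MvPowerSeries (Fin 3) k),
      Admissible b δ → 2 ≤ δ.o → δ.c = d → δ.PresBy d A N Θ → PolyDescent.InPoly d A → ¬ NCPoly.Conflict d A N →
      ∃ (Φ : Fin 3 → MvPowerSeries (Fin 3) k) (w : Fin 3 → ℕ), IsCountMove (m := 2) Φ w ∧
        MoveClause (m := 2) b Φ w (fun b' => ∃ δ' : Decoration k 2, Admissible b' δ' ∧ (δ'.o < δ.o ∨ (δ'.head = δ.head ∧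
          ∃ (A' : Fin d → MvPowerSeries (Fin 2) k) (N' : Finset (Fin 2)) (Θ' : Fin 3 → MvPowerSeries (Fin 3) k),
            δ'.PresBy d A' N' Θ' ∧ PolyDescent.WellPrepared d A' ∧
              PolyDescent.SuccFamilySel d (PolyDescent.prepSelWP (k := k) d) A N A' N'))) :=
  fun _ _ _ _ _ _ _ _ _ _ _ _ hadm ho hcd h hin hnc => h.exists_move_of_not_conflict hadm ho hcd hin hnc

/-- **`hP2c'` OF `stub_regimeLetter_of_pieces` / `stub_regimePresented_of_pieces₂` FOR `ψsel k d := PolyDescent.prepSelWP d`** (the conflict hypothesis is not needed: the point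
move is always available). -/
theorem presBy_hP2c'_prepSelWP : ∀ (p : ℕ), p.Prime → ∀ (k : Type) [Field k] [CharP k p] [IsAlgClosed k],
    ∀ (b : MvPowerSeries (Fin 3) k) (δ : Decoration k 2) (d : ℕ) (A : Fin d → MvPowerSeries (Fin 2) k) (N : Finset (Fin 2))
      (Θ : Fin 3 → MvPowerSeries (Fin 3) k),
      Admissible b δ → 2 ≤ δ.o → δ.c = d → δ.PresBy d A N Θ → PolyDescent.InPoly d A → NCPoly.Conflict d A N →
      ∃ (Φ : Fin 3 → MvPowerSeries (Fin 3) k) (w : Fin 3 → ℕ), IsCountMove (m := 2) Φ w ∧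
        MoveClause (m := 2) b Φ w (fun b' => ∃ δ' : Decoration k 2, Admissible b' δ' ∧ (δ'.o < δ.o ∨ (δ'.head = δ.head ∧
          ∃ (A' : Fin d → MvPowerSeries (Fin 2) k) (N' : Finset (Fin 2)) (Θ' : Fin 3 → MvPowerSeries (Fin 3) k),
            δ'.PresBy d A' N' Θ' ∧ PolyDescent.WellPrepared d A' ∧
              PolyDescent.PointFamilySel d (PolyDescent.prepSelWP (k := k) d) A N A' N'))) :=
  fun _ _ _ _ _ _ _ _ _ _ _ _ hadm ho hcd h hin _ => h.exists_move_point hadm ho hcd hin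

end TameFourTupleDrop

end Summit.ResolutionOfSingularities.ResolutionOfSingularities.Theorems

end
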